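import Mathlib.Analysis.Calculus.Deriv.Inv
import Literature.Geometry.Lorentzian.KerrSchild
import HarnessLib

/-!
# The Kerr metric in ingoing Kerr coordinates `(t*, r, μ, φ)`, I: components and first derivatives

Infrastructure (all results proved) for the verification that the Kerr metric is Ricci-flat for
every spin (`Kerr.isRicciFlat M a r₀`, the named fact of `KerrSchild.lean`, discharged in
`KerrRicciFlat.lean`; Kerr, PRL 11 (1963); Kerr–Schild 1965, §3). The ingoing Kerr–Schild
Cartesian chart `(t*, x, y, z)` of the prelude is re-parametrised by Kerr's ingoing coordinates:
`t*` itself, the Kerr–Schild radius `r`, the latitude cosine `μ = cos θ = z/r` and the untwisting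
azimuth `φ` of Kerr's spheroidal coordinates `x + iy = (r + ia) e^{iφ} sin θ` (Kerr 1963; Visser
arXiv:0706.0622, §4; the tree's `Kerr.kerrStar`, `KerrStarCoord.lean`). In these coordinates
`ℓ = dt* + dr − a sin²θ dφ` and `η = −dt*² + dr² − 2a sin²θ dr dφ + Σ dθ² + (r² + a²) sin²θ dφ²`
(`dθ² = dμ²/(1 − μ²)`), so the Kerr–Schild form `g = η + 2H ℓ ⊗ ℓ`, `H = Mr/Σ`, `Σ = r² + a²μ²`,
has components that are RATIONAL functions of `(r, μ)` alone:

  `g = −dt*² + dr² − a(1−μ²)(dr dφ + dφ dr) + Σ/(1−μ²) dμ² + (r²+a²)(1−μ²) dφ²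
        + (2Mr/Σ)(dt* + dr − a(1−μ²) dφ)²`

— the Kerr metric in Kerr's advanced Eddington–Finkelstein-type coordinates `(v = t* + r, r, θ, φ)`
(Kerr 1963, eq. (1); Visser arXiv:0706.0622, (E:K1)) with `v = t* + r`, `μ = cos θ`. This file
records this component field on the coordinate space `E4` (`u 0 = t*`, `u 1 = r`, `u 2 = μ`,
`u 3 = φ`) as a combination of five scalar coefficient functions with constant bilinear forms
(`Kerr.Ingoing.bilin`, `Kerr.Ingoing.bilin_apply`), and its first derivatives in closed form
(`Kerr.Ingoing.hasFDerivAt_bilin`: `∂_V g = V¹ ∂_r g + V² ∂_μ g` with explicit fields `bilinR`,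
`bilinM`). A small two-variable calculus (`Kerr.Ingoing.HasGrad`) carries the bookkeeping. The
sequels compute the second derivatives and the Koszul form (`KerrIngoingCoordChristoffel.lean`), the
chart identity with `Kerr.bilin` (`KerrIngoingCoordChart.lean`, `KerrIngoingCoordPullback.lean`) and
`Ric = 0` (`KerrIngoingCoordRicci.lean`, `KerrIngoingCoordRicciFlat.lean`, `KerrRicciFlat.lean`).
The identification with the pull-back of `Kerr.bilin` is PROVED there (`Kerr.Ingoing.kerrBilin_jac`),
so nothing here is taken on trust.

## References

* R. P. Kerr, *Gravitational field of a spinning mass as an example of algebraically special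
  metrics*, Phys. Rev. Lett. 11 (1963) 237–238, eq. (1) and the coordinates `(u, r, θ, φ)`.
* R. P. Kerr, A. Schild, *A new class of vacuum solutions of the Einstein field equations* (1965), §3.
* M. Visser, *The Kerr spacetime: a brief introduction*, arXiv:0706.0622, (E:K1)–(E:K2), (32)–(36).
-/

noncomputable section

-- instance search through the nested operator types `E4 →L[ℝ] E4 →L[ℝ] E4 →L[ℝ] ℝ`
set_option maxSynthPendingDepth 3

open Set Function

namespace Literature.Geometry.Lorentzian

namespace Kerr

namespace Ingoing

/-! ### Two-variable calculus on the coordinate space: `∂_r` and `∂_μ` -/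

/-- `f : E4 → ℝ` has Fréchet derivative `f₁ dr + f₂ dμ` at `u` (`r = u 1`, `μ = u 2`): the partial
derivatives `∂_r f = f₁`, `∂_μ f = f₂`, and `∂_{t*} f = ∂_φ f = 0`. [folklore] -/
def HasGrad (f : E4 → ℝ) (u : E4) (f₁ f₂ : ℝ) : Prop :=
  HasFDerivAt f (f₁ • E4.dx 1 + f₂ • E4.dx 2) u

namespace HasGrad

variable {f g : E4 → ℝ} {u : E4} {f₁ f₂ g₁ g₂ : ℝ}

/-- The derivative of a `HasGrad` function along `V` is `f₁ V¹ + f₂ V²`. [folklore] -/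
theorem fderiv_apply (hf : HasGrad f u f₁ f₂) (V : E4) : fderiv ℝ f u V = f₁ * V 1 + f₂ * V 2 := by
  rw [HasFDerivAt.fderiv hf]
  simp [E4.dx]

/-- `HasGrad` functions are differentiable. [folklore] -/
theorem differentiableAt (hf : HasGrad f u f₁ f₂) : DifferentiableAt ℝ f u :=
  HasFDerivAt.differentiableAt hf

/-- Change the stated partial derivatives by equal ones. [folklore] -/
theorem congr (hf : HasGrad f u f₁ f₂) {f₁' f₂' : ℝ} (h₁ : f₁ = f₁') (h₂ : f₂ = f₂') :
    HasGrad f u f₁' f₂' := by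
  subst h₁ h₂; exact hf

/-- Constants. [folklore] -/
theorem const (u : E4) (c : ℝ) : HasGrad (fun _ ↦ c) u 0 0 := by
  refine (hasFDerivAt_const c u).congr_fderiv ?_
  simp

/-- The coordinate `r = u 1`. [folklore] -/
theorem fst (u : E4) : HasGrad (fun u : E4 ↦ u 1) u 1 0 := by
  have h : HasFDerivAt (fun u : E4 ↦ u 1) (E4.dx 1) u := (E4.dx 1).hasFDerivAt
  refine h.congr_fderiv ?_
  simp

/-- The coordinate `μ = u 2`. [folklore] -/
theorem snd (u : E4) : HasGrad (fun u : E4 ↦ u 2) u 0 1 := by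
  have h : HasFDerivAt (fun u : E4 ↦ u 2) (E4.dx 2) u := (E4.dx 2).hasFDerivAt
  refine h.congr_fderiv ?_
  simp

/-- Sums. [folklore] -/
theorem add (hf : HasGrad f u f₁ f₂) (hg : HasGrad g u g₁ g₂) :
    HasGrad (fun u ↦ f u + g u) u (f₁ + g₁) (f₂ + g₂) := by
  have h := HasFDerivAt.add hf hg
  refine h.congr_fderiv ?_
  ext v; simp [E4.dx]; ring

/-- Differences. [folklore] -/
theorem sub (hf : HasGrad f u f₁ f₂) (hg : HasGrad g u g₁ g₂) :
    HasGrad (fun u ↦ f u - g u) u (f₁ - g₁) (f₂ - g₂) := by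
  have h := HasFDerivAt.sub hf hg
  refine h.congr_fderiv ?_
  ext v; simp [E4.dx]; ring

/-- Negation. [folklore] -/
theorem neg (hf : HasGrad f u f₁ f₂) : HasGrad (fun u ↦ -f u) u (-f₁) (-f₂) := by
  have h := HasFDerivAt.neg hf
  refine h.congr_fderiv ?_
  ext v; simp [E4.dx]; ring

/-- Products (Leibniz rule). [folklore] -/
theorem mul (hf : HasGrad f u f₁ f₂) (hg : HasGrad g u g₁ g₂) :
    HasGrad (fun u ↦ f u * g u) u (f₁ * g u + f u * g₁) (f₂ * g u + f u * g₂) := by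
  have h := HasFDerivAt.mul hf hg
  refine h.congr_fderiv ?_
  ext v; simp [E4.dx]; ring

/-- Constant multiples. [folklore] -/
theorem const_mul (hf : HasGrad f u f₁ f₂) (c : ℝ) :
    HasGrad (fun u ↦ c * f u) u (c * f₁) (c * f₂) := by
  have h := (const u c).mul hf
  refine h.congr ?_ ?_ <;> ring

/-- Squares. [folklore] -/
theorem sq (hf : HasGrad f u f₁ f₂) : HasGrad (fun u ↦ f u ^ 2) u (2 * f u * f₁) (2 * f u * f₂) := by
  have h := hf.mul hf
  simp only [← pow_two] at h
  refine h.congr ?_ ?_ <;> ring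

/-- Reciprocals (off the zero set). [folklore] -/
theorem inv (hf : HasGrad f u f₁ f₂) (h0 : f u ≠ 0) :
    HasGrad (fun u ↦ (f u)⁻¹) u (-f₁ / f u ^ 2) (-f₂ / f u ^ 2) := by
  have h := (hasDerivAt_inv h0).comp_hasFDerivAt u hf
  refine h.congr_fderiv ?_
  ext v; simp [E4.dx]; field_simp

/-- Quotients (off the zero set of the denominator). [folklore] -/
theorem div (hf : HasGrad f u f₁ f₂) (hg : HasGrad g u g₁ g₂) (h0 : g u ≠ 0) :
    HasGrad (fun u ↦ f u / g u) u ((f₁ * g u - f u * g₁) / g u ^ 2)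
      ((f₂ * g u - f u * g₂) / g u ^ 2) := by
  have h := hf.mul (hg.inv h0)
  simp only [← div_eq_mul_inv] at h
  refine h.congr ?_ ?_ <;> field_simp <;> ring

end HasGrad

/-! ### The scalar atoms `Σ`, `1 − μ²`, `H` and the five coefficient functions -/

/-- `Σ = r² + a²μ²` (`= r² + a² cos²θ`, the Boyer–Lindquist `ρ²`) read in the coordinates
`u = (t*, r, μ, φ)`. Visser arXiv:0706.0622, (E:K1). [cite: arXiv07060622, (E:K1)] -/
def sigma (a : ℝ) (u : E4) : ℝ := u 1 ^ 2 + a ^ 2 * u 2 ^ 2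

/-- `1 − μ² = sin²θ`. [cite: arXiv07060622, (E:K1)] -/
def sinSq (u : E4) : ℝ := 1 - u 2 ^ 2

/-- The Kerr–Schild scalar `H = Mr/Σ` in the coordinates `(t*, r, μ, φ)`. Visser arXiv:0706.0622,
(33). [cite: arXiv07060622, (33)] -/
def scalarH (M a : ℝ) (u : E4) : ℝ := M * u 1 / sigma a u

/-- `∂_r H = M(a²μ² − r²)/Σ²`. [folklore] -/
def scalarHr (M a : ℝ) (u : E4) : ℝ := M * (a ^ 2 * u 2 ^ 2 - u 1 ^ 2) / sigma a u ^ 2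

/-- `∂_μ H = −2Ma²rμ/Σ²`. [folklore] -/
def scalarHm (M a : ℝ) (u : E4) : ℝ := -(2 * M * a ^ 2 * u 1 * u 2) / sigma a u ^ 2

/-- Coefficient of `dr dφ + dφ dr`: `c₁₃ = −a(1 − μ²)`. [cite: arXiv07060622, (E:K1)] -/
def c13 (a : ℝ) (u : E4) : ℝ := -(a * sinSq u)

/-- Coefficient of `dμ²`: `c₂₂ = Σ/(1 − μ²)`. [cite: arXiv07060622, (E:K1)] -/
def c22 (a : ℝ) (u : E4) : ℝ := sigma a u / sinSq u

/-- Coefficient of `dφ²`: `c₃₃ = (r² + a²)(1 − μ²) + 2H a²(1 − μ²)²`. [cite: arXiv07060622, (E:K1)] -/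
def c33 (M a : ℝ) (u : E4) : ℝ :=
  (u 1 ^ 2 + a ^ 2) * sinSq u + a ^ 2 * sinSq u ^ 2 * (2 * scalarH M a u)

/-- Coefficient of `(dt* + dr)²`: `h₀₀ = 2H`. [cite: arXiv07060622, (E:K1)] -/
def h00 (M a : ℝ) (u : E4) : ℝ := 2 * scalarH M a u

/-- Coefficient of `(dt* + dr) dφ + dφ (dt* + dr)`: `h₀₃ = −2Ha(1 − μ²)`. [cite: arXiv07060622, (E:K1)] -/
def h03 (M a : ℝ) (u : E4) : ℝ := -(a * sinSq u) * (2 * scalarH M a u)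

/-! ### The constant bilinear forms and the component field -/

/-- `ℓ₀ = dt* + dr`, the `μ`-independent part of `ℓ = dt* + dr − a sin²θ dφ`. [cite: arXiv07060622, (E:K1)] -/
def ell0 : E4 →L[ℝ] ℝ := E4.dx 0 + E4.dx 1

/-- `−dt*² + dr²`. [folklore] -/
def B0 : E4 →L[ℝ] E4 →L[ℝ] ℝ := -E4.tmul (E4.dx 0) (E4.dx 0) + E4.tmul (E4.dx 1) (E4.dx 1)

/-- `dr ⊗ dφ + dφ ⊗ dr`. [folklore] -/
def B13 : E4 →L[ℝ] E4 →L[ℝ] ℝ := E4.tmul (E4.dx 1) (E4.dx 3) + E4.tmul (E4.dx 3) (E4.dx 1)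

/-- `dμ ⊗ dμ`. [folklore] -/
def B22 : E4 →L[ℝ] E4 →L[ℝ] ℝ := E4.tmul (E4.dx 2) (E4.dx 2)

/-- `dφ ⊗ dφ`. [folklore] -/
def B33 : E4 →L[ℝ] E4 →L[ℝ] ℝ := E4.tmul (E4.dx 3) (E4.dx 3)

/-- `ℓ₀ ⊗ ℓ₀`. [folklore] -/
def L00 : E4 →L[ℝ] E4 →L[ℝ] ℝ := E4.tmul ell0 ell0

/-- `ℓ₀ ⊗ dφ + dφ ⊗ ℓ₀`. [folklore] -/
def L03 : E4 →L[ℝ] E4 →L[ℝ] ℝ := E4.tmul ell0 (E4.dx 3) + E4.tmul (E4.dx 3) ell0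

/-- **The Kerr metric components in ingoing Kerr coordinates** `u = (t*, r, μ, φ)`:
`g = (−dt*² + dr²) + c₁₃ (dr dφ + dφ dr) + c₂₂ dμ² + c₃₃ dφ² + h₀₀ ℓ₀² + h₀₃ (ℓ₀ dφ + dφ ℓ₀)`,
`ℓ₀ = dt* + dr` — the expansion of `η + 2H ℓ ⊗ ℓ` with `ℓ = ℓ₀ − a(1−μ²) dφ`,
`η = −dt*² + dr² − a(1−μ²)(dr dφ + dφ dr) + Σ/(1−μ²) dμ² + (r²+a²)(1−μ²) dφ²`. Kerr 1963, eq. (1)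
(with `v = t* + r`, `μ = cos θ`); Visser arXiv:0706.0622, (E:K1). [cite: arXiv07060622, (E:K1)] -/
def bilin (M a : ℝ) (u : E4) : E4 →L[ℝ] E4 →L[ℝ] ℝ :=
  B0 + c13 a u • B13 + c22 a u • B22 + c33 M a u • B33 + h00 M a u • L00 + h03 M a u • L03

/-- `ℓ₀(v) = v⁰ + v¹`. [folklore] -/
@[simp]
theorem ell0_apply (v : E4) : ell0 v = v 0 + v 1 := by
  simp [ell0]

/-- **The components, evaluated**: `g_u(v, w)` as an explicit rational expression in `r, μ`.
[cite: arXiv07060622, (E:K1)] -/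
theorem bilin_apply (M a : ℝ) (u v w : E4) :
    bilin M a u v w =
      -(v 0 * w 0) + v 1 * w 1 + c13 a u * (v 1 * w 3 + v 3 * w 1) + c22 a u * (v 2 * w 2) +
        c33 M a u * (v 3 * w 3) + h00 M a u * ((v 0 + v 1) * (w 0 + w 1)) +
        h03 M a u * ((v 0 + v 1) * w 3 + v 3 * (w 0 + w 1)) := by
  simp only [bilin, B0, B13, B22, B33, L00, L03, add_apply,
    smul_apply, neg_apply, E4.tmul_apply, ell0_apply,
    smul_eq_mul, E4.dx, PiLp.proj_apply]

/-- The components are symmetric. [folklore] -/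
theorem bilin_symm (M a : ℝ) (u v w : E4) : bilin M a u v w = bilin M a u w v := by
  rw [bilin_apply, bilin_apply]; ring

/-! ### First derivatives of the atoms and of the coefficients -/

section Deriv

variable (M a : ℝ) {u : E4}

/-- `∂Σ = 2r dr + 2a²μ dμ`. [folklore] -/
theorem hasGrad_sigma (u : E4) : HasGrad (sigma a) u (2 * u 1) (2 * a ^ 2 * u 2) := by
  have h := ((HasGrad.fst u).sq).add (((HasGrad.snd u).sq).const_mul (a ^ 2))
  refine (h.congr ?_ ?_) <;> ring

/-- `∂(1 − μ²) = −2μ dμ`. [folklore] -/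
theorem hasGrad_sinSq (u : E4) : HasGrad sinSq u 0 (-(2 * u 2)) := by
  have h := (HasGrad.const u 1).sub (HasGrad.snd u).sq
  refine (h.congr ?_ ?_) <;> ring

/-- `∂H = H_r dr + H_μ dμ` with `H_r = M(a²μ² − r²)/Σ²`, `H_μ = −2Ma²rμ/Σ²` (`Σ ≠ 0`). [folklore] -/
theorem hasGrad_scalarH (hS : sigma a u ≠ 0) :
    HasGrad (scalarH M a) u (scalarHr M a u) (scalarHm M a u) := by
  have h := ((HasGrad.fst u).const_mul M).div (hasGrad_sigma a u) hS
  refine h.congr ?_ ?_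
  · simp only [scalarHr, sigma, mul_one]; ring
  · simp only [scalarHm, sigma, mul_zero, zero_mul, zero_sub]; ring

/-- `∂c₁₃ = 2aμ dμ`. [folklore] -/
theorem hasGrad_c13 (u : E4) : HasGrad (c13 a) u 0 (2 * a * u 2) := by
  have h := ((hasGrad_sinSq u).const_mul a).neg
  refine h.congr ?_ ?_ <;> ring

/-- `∂_r c₂₂ = 2r/(1 − μ²)`. [folklore] -/
def c22r (u : E4) : ℝ := 2 * u 1 / sinSq u

/-- `∂_μ c₂₂ = 2μ(r² + a²)/(1 − μ²)²`. [folklore] -/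
def c22m (a : ℝ) (u : E4) : ℝ := 2 * u 2 * (u 1 ^ 2 + a ^ 2) / sinSq u ^ 2

/-- `∂c₂₂ = c₂₂ʳ dr + c₂₂ᵘ dμ` (`μ² ≠ 1`). [folklore] -/
theorem hasGrad_c22 (hP : sinSq u ≠ 0) : HasGrad (c22 a) u (c22r u) (c22m a u) := by
  have h := (hasGrad_sigma a u).div (hasGrad_sinSq u) hP
  refine h.congr ?_ ?_
  · simp only [c22r, mul_zero, sub_zero]
    field_simp
  · simp only [c22m, sigma, sinSq]
    field_simp
    ring

/-- `∂_r h₀₀ = 2H_r`. [folklore] -/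
def h00r (M a : ℝ) (u : E4) : ℝ := 2 * scalarHr M a u

/-- `∂_μ h₀₀ = 2H_μ`. [folklore] -/
def h00m (M a : ℝ) (u : E4) : ℝ := 2 * scalarHm M a u

/-- `∂h₀₀ = 2H_r dr + 2H_μ dμ`. [folklore] -/
theorem hasGrad_h00 (hS : sigma a u ≠ 0) : HasGrad (h00 M a) u (h00r M a u) (h00m M a u) :=
  (hasGrad_scalarH M a hS).const_mul 2

/-- `∂_r h₀₃ = −a(1−μ²) 2H_r`. [folklore] -/
def h03r (M a : ℝ) (u : E4) : ℝ := -(a * sinSq u) * h00r M a u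

/-- `∂_μ h₀₃ = 2aμ · 2H − a(1−μ²) 2H_μ`. [folklore] -/
def h03m (M a : ℝ) (u : E4) : ℝ := 2 * a * u 2 * h00 M a u + -(a * sinSq u) * h00m M a u

/-- `∂h₀₃` (product rule on `c₁₃ · h₀₀`). [folklore] -/
theorem hasGrad_h03 (hS : sigma a u ≠ 0) : HasGrad (h03 M a) u (h03r M a u) (h03m M a u) := by
  have h := (hasGrad_c13 a u).mul (hasGrad_h00 M a hS)
  refine h.congr ?_ ?_
  · simp only [h03r, c13, zero_mul, zero_add]
  · simp only [h03m, c13]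

/-- `∂_r c₃₃ = 2r(1−μ²) + a²(1−μ²)² 2H_r`. [folklore] -/
def c33r (M a : ℝ) (u : E4) : ℝ := 2 * u 1 * sinSq u + a ^ 2 * sinSq u ^ 2 * h00r M a u

/-- `∂_μ c₃₃ = −2μ(r²+a²) − 4a²μ(1−μ²) 2H + a²(1−μ²)² 2H_μ`. [folklore] -/
def c33m (M a : ℝ) (u : E4) : ℝ :=
  -(2 * u 2 * (u 1 ^ 2 + a ^ 2)) + -(4 * a ^ 2 * u 2 * sinSq u) * h00 M a u +
    a ^ 2 * sinSq u ^ 2 * h00m M a u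

/-- `∂c₃₃` (product rules). [folklore] -/
theorem hasGrad_c33 (hS : sigma a u ≠ 0) : HasGrad (c33 M a) u (c33r M a u) (c33m M a u) := by
  have h1 := (((HasGrad.fst u).sq).add (HasGrad.const u (a ^ 2))).mul (hasGrad_sinSq u)
  have h2 := (((hasGrad_sinSq u).sq).const_mul (a ^ 2)).mul (hasGrad_h00 M a hS)
  have h := h1.add h2
  refine h.congr ?_ ?_
  · simp only [c33r, h00]; ring
  · simp only [c33m, h00]; ring

/-! ### The first derivatives of the component field -/

/-- **`∂_r g`** in closed form: `c₂₂ʳ dμ² + c₃₃ʳ dφ² + h₀₀ʳ ℓ₀² + h₀₃ʳ (ℓ₀ dφ + dφ ℓ₀)`. [folklore] -/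
def bilinR (M a : ℝ) (u : E4) : E4 →L[ℝ] E4 →L[ℝ] ℝ :=
  c22r u • B22 + c33r M a u • B33 + h00r M a u • L00 + h03r M a u • L03

/-- **`∂_μ g`** in closed form: `2aμ (dr dφ + dφ dr) + c₂₂ᵘ dμ² + c₃₃ᵘ dφ² + h₀₀ᵘ ℓ₀² + h₀₃ᵘ (ℓ₀ dφ + dφ ℓ₀)`.
[folklore] -/
def bilinM (M a : ℝ) (u : E4) : E4 →L[ℝ] E4 →L[ℝ] ℝ :=
  (2 * a * u 2) • B13 + c22m a u • B22 + c33m M a u • B33 + h00m M a u • L00 + h03m M a u • L03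

/-- A `HasGrad` coefficient times a constant form has derivative `V ↦ (f₁V¹ + f₂V²) B`. [folklore] -/
theorem HasGrad.smul_const {f : E4 → ℝ} {u : E4} {f₁ f₂ : ℝ} (hf : HasGrad f u f₁ f₂)
    (B : E4 →L[ℝ] E4 →L[ℝ] ℝ) :
    HasFDerivAt (fun u ↦ f u • B) ((E4.dx 1).smulRight (f₁ • B) + (E4.dx 2).smulRight (f₂ • B)) u := by
  have h := HasFDerivAt.smul_const hf B
  refine h.congr_fderiv ?_
  ext V v w
  simp only [ContinuousLinearMap.smulRight_apply, add_apply,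
    smul_apply, smul_eq_mul]
  ring

/-- **The first derivatives of the Kerr components**: at a point with `Σ ≠ 0` and `μ² ≠ 1`,
`Dg(u)(V) = V¹ ∂_r g + V² ∂_μ g` with `∂_r g = bilinR`, `∂_μ g = bilinM`. [folklore] -/
theorem hasFDerivAt_bilin (hS : sigma a u ≠ 0) (hP : sinSq u ≠ 0) :
    HasFDerivAt (bilin M a)
      ((E4.dx 1).smulRight (bilinR M a u) + (E4.dx 2).smulRight (bilinM M a u)) u := by
  have h := ((((hasFDerivAt_const B0 u).add ((hasGrad_c13 a u).smul_const B13)).add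
    ((hasGrad_c22 a hP).smul_const B22)).add ((hasGrad_c33 M a hS).smul_const B33)).add
    ((hasGrad_h00 M a hS).smul_const L00) |>.add ((hasGrad_h03 M a hS).smul_const L03)
  refine h.congr_fderiv ?_
  ext V v w
  simp only [bilinR, bilinM, ContinuousLinearMap.smulRight_apply, add_apply,
    smul_apply, smul_eq_mul, zero_smul,
    smul_zero, zero_add]
  ring

/-- `∂_V g(v, w) = V¹ (∂_r g)(v, w) + V² (∂_μ g)(v, w)`. [folklore] -/
theorem fderiv_bilin_apply (hS : sigma a u ≠ 0) (hP : sinSq u ≠ 0) (V v w : E4) :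
    fderiv ℝ (bilin M a) u V v w = V 1 * bilinR M a u v w + V 2 * bilinM M a u v w := by
  rw [(hasFDerivAt_bilin M a hS hP).fderiv]
  simp only [add_apply, ContinuousLinearMap.smulRight_apply,
    smul_apply, smul_eq_mul]
  simp only [E4.dx, PiLp.proj_apply]

/-- `(∂_r g)(v, w)` evaluated. [folklore] -/
theorem bilinR_apply (u v w : E4) :
    bilinR M a u v w = c22r u * (v 2 * w 2) + c33r M a u * (v 3 * w 3) +
      h00r M a u * ((v 0 + v 1) * (w 0 + w 1)) + h03r M a u * ((v 0 + v 1) * w 3 + v 3 * (w 0 + w 1)) := by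
  simp only [bilinR, B22, B33, L00, L03, add_apply,
    smul_apply, E4.tmul_apply, ell0_apply, smul_eq_mul, E4.dx, PiLp.proj_apply]

/-- `(∂_μ g)(v, w)` evaluated. [folklore] -/
theorem bilinM_apply (u v w : E4) :
    bilinM M a u v w = 2 * a * u 2 * (v 1 * w 3 + v 3 * w 1) + c22m a u * (v 2 * w 2) +
      c33m M a u * (v 3 * w 3) + h00m M a u * ((v 0 + v 1) * (w 0 + w 1)) +
      h03m M a u * ((v 0 + v 1) * w 3 + v 3 * (w 0 + w 1)) := by
  simp only [bilinM, B13, B22, B33, L00, L03, add_apply,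
    smul_apply, E4.tmul_apply, ell0_apply, smul_eq_mul, E4.dx, PiLp.proj_apply]

end Deriv

end Ingoing

end Kerr

end Literature.Geometry.Lorentzian

end
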